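import Literature.Geometry.ComplexAnalytic.EvenQuarticWeierstrassBifurcation
import Literature.Analysis.Complex.SeveralVariables
import HarnessLib

/-!
# The two branches `λ₂ = 0` and `4λ₂ = λ₁²` of an even quartic Weierstrass decomposition, pulled back to the
# parameter plane: the axis `β = 0` and a holomorphic graph `β = φ(α)` (AGZV II §5.2, fig. 48)

Family `hodge`, layer `Literature/Geometry/ComplexAnalytic`, sequel of `EvenQuarticWeierstrassBifurcation` (an even
holomorphic `f(μ, u)` of order four in `u` is `(u⁴ + λ₁(μ)u² + λ₂(μ))·unit`, and zero is a critical value of `f(μ, ·)`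
iff `λ₂(μ) = 0 ∨ 4λ₂(μ) = λ₁(μ)²`).  Written by the prover seat `hodge-nonav-19716-p2` (g8, cell `hodge-nonav`) for
programme B2-BIF (bifurcation half `IsSymmetricA3Bifurcation` of the binder hB2 `picardLefschetz_symmetricA3` of crux K1-B,
`Summits/HodgeConjecture/HodgeConjecture/Theses/SignSymmetricPowers.lean`, stmt-HodgeConjecture-19716).

For the symmetric `A₃` unfolding `f₁ + α g₂ + β g₀` the parameter is `μ = (α, β)`; the reduced function vanishes on the
axis `β = 0` at `u = 0` (the `A₃` point persists as a critical point of `f₁ + α g₂`) and `∂_β f(0, 0) = g₀(e_j) ≠ 0`.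
Under exactly these two hypotheses this file identifies the two components of `Σ(B₂)` in the `(α, β)`-plane ("read
through the local substitution `(a, b) ↦ (λ₁, λ₂)`" of `PicardLefschetzSymmetricA3`):

* `fderiv_l₂_apply_ne_zero` — `∂_β λ₂(0) ≠ 0` (from `f(μ, 0) = λ₂(μ)·U(μ, 0)`);
* `eventually_l₂_eq_zero_iff` — near `0`: `λ₂(μ) = 0 ↔ β = 0` (holomorphic implicit function theorem
  `SCV.exists_straightening` and the axis hypothesis);
* `exists_branch_graph` — near `0`: `4λ₂(μ) = λ₁(μ)² ↔ β = φ(α)` for a holomorphic `φ` with `φ(0) = 0`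
  (straightening of `λ₁² − 4λ₂`, whose `β`-derivative at `0` is `−4∂_βλ₂(0) ≠ 0` since `λ₁(0) = 0`).

## References
* [ArnoldGuseinzadeVarchenko2012] V. I. Arnold, S. M. Gusein-Zade, A. N. Varchenko, *Singularities of Differentiable
  Maps, Volume 2*, Birkhäuser 2012, Part I §5.2 (level bifurcation set of `B₂`: `λ₂ = 0 ∪ λ₁² = 4λ₂`, fig. 48,
  pp. 132–133 of the held text).
* [Chirka1989] E. M. Chirka, *Complex Analytic Sets*, Kluwer 1989, §1.1 and A2.2 (implicit functions).
-/

noncomputable section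

open Polynomial Metric Set Filter Complex
open scoped Topology
open Literature.Analysis.Complex Literature.Analysis.Complex.SCV

namespace Literature.Geometry.ComplexAnalytic

namespace BoundarySingularity

/-- A linear form `L` on `ℂ²` with `L(0, 1) ≠ 0` together with the first projection is a linear bijection of `ℂ²`
(the hypothesis of `SCV.exists_straightening` for an implicit function of the first coordinate). [folklore] -/
private theorem bijective_prod_fst {L : ℂ × ℂ →L[ℂ] ℂ} (h : L (0, 1) ≠ 0) :
    Function.Bijective ((L).prod (ContinuousLinearMap.fst ℂ ℂ ℂ)) := by
  have hinj : Function.Injective ((L).prod (ContinuousLinearMap.fst ℂ ℂ ℂ)) := by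
    refine (injective_iff_map_eq_zero _).2 fun v hv => ?_
    have h1 : L v = 0 := congr_arg Prod.fst hv
    have h2 : v.1 = 0 := congr_arg Prod.snd hv
    have hv' : v = v.2 • ((0 : ℂ), (1 : ℂ)) := by
      ext <;> simp [h2]
    rw [hv', map_smul, smul_eq_mul] at h1
    have h3 : v.2 = 0 := (mul_eq_zero.1 h1).resolve_right h
    rw [hv', h3, zero_smul]
  refine ⟨hinj, ?_⟩
  have hinj' : Function.Injective
      (((L).prod (ContinuousLinearMap.fst ℂ ℂ ℂ) : ℂ × ℂ →L[ℂ] ℂ × ℂ) : ℂ × ℂ →ₗ[ℂ] ℂ × ℂ) := hinj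
  exact LinearMap.injective_iff_surjective.1 hinj'

variable {f : (ℂ × ℂ) × ℂ → ℂ} {ε ρ : ℝ} {l₁ l₂ : ℂ × ℂ → ℂ} {U : (ℂ × ℂ) × ℂ → ℂ}

/-- On the polydisc, `f(μ, 0) = λ₂(μ)·U(μ, 0)`. [cite: ArnoldGuseinzadeVarchenko2012, Part I §5.2] -/
theorem apply_zero_eq_l₂_mul (hρ : 0 < ρ)
    (hfact : ∀ p ∈ ball (0 : ℂ × ℂ) ε ×ˢ ball (0 : ℂ) ρ, f p = (p.2 ^ 4 + l₁ p.1 * p.2 ^ 2 + l₂ p.1) * U p)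
    {μ : ℂ × ℂ} (hμ : μ ∈ ball (0 : ℂ × ℂ) ε) : f (μ, 0) = l₂ μ * U (μ, 0) := by
  rw [hfact (μ, 0) (mk_mem_prod hμ (mem_ball_self hρ))]
  simp

/-- **`∂_β λ₂(0) ≠ 0`.**  If `f(μ, 0) = λ₂(μ)·U(μ, 0)` on the polydisc with `U(0) ≠ 0`, `λ₂(0) = 0`, and `μ ↦ f(μ, 0)`
has derivative `L` at `0` with `L(0, 1) ≠ 0`, then the derivative of `λ₂` at `0` does not kill `(0, 1)` — the
substitution `(α, β) ↦ (λ₁, λ₂)` is submersive onto the `λ₂`-axis. [cite: ArnoldGuseinzadeVarchenko2012, Part I §5.2] -/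
theorem fderiv_l₂_apply_ne_zero (hε : 0 < ε) (hρ : 0 < ρ) (hl₂ : DifferentiableOn ℂ l₂ (ball 0 ε)) (hl₂0 : l₂ 0 = 0)
    (hUd : DifferentiableOn ℂ U (ball (0 : ℂ × ℂ) ε ×ˢ ball (0 : ℂ) ρ))
    (hfact : ∀ p ∈ ball (0 : ℂ × ℂ) ε ×ˢ ball (0 : ℂ) ρ, f p = (p.2 ^ 4 + l₁ p.1 * p.2 ^ 2 + l₂ p.1) * U p)
    {L : ℂ × ℂ →L[ℂ] ℂ} (hL : HasFDerivAt (fun μ : ℂ × ℂ => f (μ, 0)) L 0) (hL1 : L (0, 1) ≠ 0) :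
    fderiv ℂ l₂ 0 (0, 1) ≠ 0 := by
  have h00 : ((0 : ℂ × ℂ), (0 : ℂ)) ∈ ball (0 : ℂ × ℂ) ε ×ˢ ball (0 : ℂ) ρ :=
    mk_mem_prod (mem_ball_self hε) (mem_ball_self hρ)
  have hl₂' : HasFDerivAt l₂ (fderiv ℂ l₂ 0) 0 :=
    (hl₂.differentiableAt (isOpen_ball.mem_nhds (mem_ball_self hε))).hasFDerivAt
  have hU0 : DifferentiableAt ℂ (fun μ : ℂ × ℂ => U (μ, 0)) 0 := by
    have h1 : DifferentiableAt ℂ U ((0 : ℂ × ℂ), (0 : ℂ)) :=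
      hUd.differentiableAt ((isOpen_ball.prod isOpen_ball).mem_nhds h00)
    exact h1.comp (0 : ℂ × ℂ) (differentiableAt_id.prodMk (differentiableAt_const _))
  have hprod := hl₂'.mul hU0.hasFDerivAt
  have hev : (fun μ : ℂ × ℂ => f (μ, 0)) =ᶠ[𝓝 0] fun μ => l₂ μ * U (μ, 0) := by
    filter_upwards [isOpen_ball.mem_nhds (mem_ball_self hε)] with μ hμ
    exact apply_zero_eq_l₂_mul hρ hfact hμ
  have hL' : HasFDerivAt (fun μ : ℂ × ℂ => f (μ, 0))
      (l₂ 0 • fderiv ℂ (fun μ : ℂ × ℂ => U (μ, 0)) 0 + U ((0 : ℂ × ℂ), 0) • fderiv ℂ l₂ 0) 0 :=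
    hprod.congr_of_eventuallyEq hev
  have hLeq := hL.unique hL'
  intro h0
  apply hL1
  rw [hLeq]
  show l₂ 0 * fderiv ℂ (fun μ : ℂ × ℂ => U (μ, 0)) 0 (0, 1) + U ((0 : ℂ × ℂ), 0) * fderiv ℂ l₂ 0 (0, 1) = 0
  rw [h0, hl₂0, zero_mul, mul_zero, add_zero]

/-- **The branch `λ₂ = 0` is the axis `β = 0`.**  In the situation of `exists_even_quartic_preparation`, suppose moreover
that `f((α, 0), 0) = 0` for `α` near `0` and that `μ ↦ f(μ, 0)` has a derivative `L` at `0` with `L(0, 1) ≠ 0`.  Then for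
`μ = (α, β)` near `0`: `λ₂(μ) = 0 ↔ β = 0`.  (`λ₂ = 0 ⟺ f(μ, 0) = 0`; the zero set of `μ ↦ f(μ, 0)` near `0` is a
holomorphic graph over the `α`-axis by the implicit function theorem, and it contains the axis.)
[cite: ArnoldGuseinzadeVarchenko2012, Part I §5.2 (the component `λ₂ = 0`, held text chunk p0133)] [cite: Chirka1989, A2.2] -/
theorem eventually_l₂_eq_zero_iff (hε : 0 < ε) (hρ : 0 < ρ) (hl₂ : DifferentiableOn ℂ l₂ (ball 0 ε))
    (hUd : DifferentiableOn ℂ U (ball (0 : ℂ × ℂ) ε ×ˢ ball (0 : ℂ) ρ))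
    (hUne : ∀ p ∈ ball (0 : ℂ × ℂ) ε ×ˢ ball (0 : ℂ) ρ, U p ≠ 0)
    (hfact : ∀ p ∈ ball (0 : ℂ × ℂ) ε ×ˢ ball (0 : ℂ) ρ, f p = (p.2 ^ 4 + l₁ p.1 * p.2 ^ 2 + l₂ p.1) * U p)
    (haxis : ∀ᶠ α in 𝓝 (0 : ℂ), f ((α, 0), 0) = 0)
    {L : ℂ × ℂ →L[ℂ] ℂ} (hL : HasFDerivAt (fun μ : ℂ × ℂ => f (μ, 0)) L 0) (hL1 : L (0, 1) ≠ 0) :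
    ∀ᶠ μ in 𝓝 (0 : ℂ × ℂ), l₂ μ = 0 ↔ μ.2 = 0 := by
  set g : ℂ × ℂ → ℂ := fun μ => f (μ, 0) with hg
  have hgeq : ∀ μ ∈ ball (0 : ℂ × ℂ) ε, g μ = l₂ μ * U (μ, 0) := fun μ hμ => apply_zero_eq_l₂_mul hρ hfact hμ
  have hU0d : DifferentiableOn ℂ (fun μ : ℂ × ℂ => U (μ, 0)) (ball 0 ε) :=
    hUd.comp (differentiableOn_id.prodMk (differentiableOn_const _)) fun μ hμ => mk_mem_prod hμ (mem_ball_self hρ)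
  have hgd : DifferentiableOn ℂ g (ball 0 ε) := (hl₂.mul hU0d).congr hgeq
  have hbij : Function.Bijective ((fderiv ℂ g 0).prod (ContinuousLinearMap.fst ℂ ℂ ℂ)) := by
    rw [hL.fderiv]; exact bijective_prod_fst hL1
  obtain ⟨S, T, Ψ, hS, h0S, hSW, -, -, hleft, -, -⟩ :=
    exists_straightening hgd isOpen_ball (mem_ball_self hε) (ContinuousLinearMap.fst ℂ ℂ ℂ) hbij
  -- near `0`: `μ ∈ S`, `(α, 0) ∈ S` and `g(α, 0) = 0`
  have h1 : ∀ᶠ μ in 𝓝 (0 : ℂ × ℂ), μ ∈ S := hS.mem_nhds h0S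
  have hc : Continuous fun μ : ℂ × ℂ => ((μ.1, 0) : ℂ × ℂ) := by fun_prop
  have hc0 : (fun μ : ℂ × ℂ => ((μ.1, 0) : ℂ × ℂ)) 0 = 0 := rfl
  have h2 : ∀ᶠ μ in 𝓝 (0 : ℂ × ℂ), ((μ.1, 0) : ℂ × ℂ) ∈ S := by
    have := hc.continuousAt.eventually_mem (hc0 ▸ hS.mem_nhds h0S :)
    exact this
  have h3 : ∀ᶠ μ in 𝓝 (0 : ℂ × ℂ), f (((μ.1, 0) : ℂ × ℂ), 0) = 0 :=
    (continuous_fst.tendsto' (0 : ℂ × ℂ) (0 : ℂ) rfl).eventually haxis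
  filter_upwards [h1, h2, h3] with μ hμS hμ1S hax
  have key : ∀ z ∈ S, g z = 0 → Ψ (0, z.1) = z := by
    intro z hz hz0
    have h := (hleft z hz).2
    rw [hz0] at h
    simpa using h
  constructor
  · intro hl
    have hgμ : g μ = 0 := by rw [hgeq μ (hSW hμS), hl, zero_mul]
    have e1 := key μ hμS hgμ
    have e2 : Ψ (0, μ.1) = ((μ.1, 0) : ℂ × ℂ) := key ((μ.1, 0) : ℂ × ℂ) hμ1S hax
    have : μ = ((μ.1, 0) : ℂ × ℂ) := e1.symm.trans e2
    exact (congr_arg Prod.snd this).trans rfl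
  · intro hβ
    have hμeq : μ = ((μ.1, 0) : ℂ × ℂ) := Prod.ext rfl hβ
    have hgμ : g μ = 0 := by rw [hμeq]; exact hax
    rw [hgeq μ (hSW hμS)] at hgμ
    exact (mul_eq_zero.1 hgμ).resolve_right (hUne _ (mk_mem_prod (hSW hμS) (mem_ball_self hρ)))

/-- **The branch `4λ₂ = λ₁²` is a holomorphic graph `β = φ(α)`.**  In the situation of
`exists_even_quartic_preparation` (`λ₁, λ₂` holomorphic on `|μ| < ε`, `λ₁(0) = λ₂(0) = 0`), suppose `μ ↦ f(μ, 0)` has a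
derivative `L` at `0` with `L(0, 1) ≠ 0`.  Then there are `δ > 0` and `φ` holomorphic on `|α| < δ` with `φ(0) = 0`
such that for `|μ| < δ`: `4λ₂(μ) = λ₁(μ)² ↔ β = φ(α)`.  (Straightening of `D = λ₁² − 4λ₂`: `∂_β D(0) = −4∂_βλ₂(0) ≠ 0`.)
[cite: ArnoldGuseinzadeVarchenko2012, Part I §5.2 (the component `λ₁² = 4λ₂`, fig. 48)] [cite: Chirka1989, A2.2] -/
theorem exists_branch_graph (hε : 0 < ε) (hρ : 0 < ρ) (hl₁ : DifferentiableOn ℂ l₁ (ball 0 ε))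
    (hl₂ : DifferentiableOn ℂ l₂ (ball 0 ε)) (hl₁0 : l₁ 0 = 0) (hl₂0 : l₂ 0 = 0)
    (hUd : DifferentiableOn ℂ U (ball (0 : ℂ × ℂ) ε ×ˢ ball (0 : ℂ) ρ))
    (hfact : ∀ p ∈ ball (0 : ℂ × ℂ) ε ×ˢ ball (0 : ℂ) ρ, f p = (p.2 ^ 4 + l₁ p.1 * p.2 ^ 2 + l₂ p.1) * U p)
    {L : ℂ × ℂ →L[ℂ] ℂ} (hL : HasFDerivAt (fun μ : ℂ × ℂ => f (μ, 0)) L 0) (hL1 : L (0, 1) ≠ 0) :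
    ∃ (δ : ℝ) (φ : ℂ → ℂ), 0 < δ ∧ DifferentiableOn ℂ φ (ball 0 δ) ∧ φ 0 = 0 ∧
      ∀ μ ∈ ball (0 : ℂ × ℂ) δ, (4 * l₂ μ = l₁ μ ^ 2 ↔ μ.2 = φ μ.1) := by
  have hdl₂ := fderiv_l₂_apply_ne_zero hε hρ hl₂ hl₂0 hUd hfact hL hL1
  -- the discriminant `D = λ₁² − 4λ₂` and its derivative at `0`
  set D : ℂ × ℂ → ℂ := fun μ => l₁ μ * l₁ μ - 4 * l₂ μ with hD
  have hDd : DifferentiableOn ℂ D (ball 0 ε) := (hl₁.mul hl₁).sub (hl₂.const_mul 4)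
  have hl₁' : HasFDerivAt l₁ (fderiv ℂ l₁ 0) 0 :=
    (hl₁.differentiableAt (isOpen_ball.mem_nhds (mem_ball_self hε))).hasFDerivAt
  have hl₂' : HasFDerivAt l₂ (fderiv ℂ l₂ 0) 0 :=
    (hl₂.differentiableAt (isOpen_ball.mem_nhds (mem_ball_self hε))).hasFDerivAt
  have hD' : HasFDerivAt D (l₁ 0 • fderiv ℂ l₁ 0 + l₁ 0 • fderiv ℂ l₁ 0 - (4 : ℂ) • fderiv ℂ l₂ 0) 0 :=
    (hl₁'.mul hl₁').sub (hl₂'.const_mul 4)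
  have hD1 : fderiv ℂ D 0 (0, 1) ≠ 0 := by
    rw [hD'.fderiv]
    show l₁ 0 * fderiv ℂ l₁ 0 (0, 1) + l₁ 0 * fderiv ℂ l₁ 0 (0, 1) - 4 * fderiv ℂ l₂ 0 (0, 1) ≠ 0
    rw [hl₁0]
    intro h
    apply hdl₂
    linear_combination -h / 4
  have hbij : Function.Bijective ((fderiv ℂ D 0).prod (ContinuousLinearMap.fst ℂ ℂ ℂ)) := bijective_prod_fst hD1
  obtain ⟨S, T, Ψ, hS, h0S, hSW, hT, hΨ, hleft, hright, -⟩ :=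
    exists_straightening hDd isOpen_ball (mem_ball_self hε) (ContinuousLinearMap.fst ℂ ℂ ℂ) hbij
  have hD0 : D 0 = 0 := by simp [hD, hl₁0, hl₂0]
  -- radius: `ball 0 δ ⊆ S` and `(0, α) ∈ T` for `|α| < δ`
  obtain ⟨δ₁, hδ₁, hδ₁S⟩ := Metric.isOpen_iff.1 hS 0 h0S
  have h0T : ((0 : ℂ), (0 : ℂ)) ∈ T := by
    have h := (hleft 0 h0S).1
    rw [hD0] at h
    simpa using h
  have hι : Continuous fun α : ℂ => ((0 : ℂ), α) := by fun_prop
  obtain ⟨δ₂, hδ₂, hδ₂T⟩ := Metric.isOpen_iff.1 (hT.preimage hι) 0 h0T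
  set φ : ℂ → ℂ := fun α => (Ψ (0, α)).2 with hφ
  refine ⟨min δ₁ δ₂, φ, lt_min hδ₁ hδ₂, ?_, ?_, fun μ hμ => ?_⟩
  · -- `φ` is holomorphic on `|α| < δ₂`
    have hmaps : MapsTo (fun α : ℂ => ((0 : ℂ), α)) (ball 0 (min δ₁ δ₂)) T := fun α hα =>
      hδ₂T (ball_subset_ball (min_le_right _ _) hα)
    have h1 : DifferentiableOn ℂ (fun α : ℂ => Ψ (0, α)) (ball 0 (min δ₁ δ₂)) :=
      hΨ.comp ((differentiableOn_const _).prodMk differentiableOn_id) hmaps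
    exact h1.snd
  · -- `φ 0 = 0`
    have h := (hleft 0 h0S).2
    rw [hD0] at h
    show (Ψ (0, 0)).2 = 0
    have h' : Ψ (0, 0) = 0 := by simpa using h
    rw [h']; rfl
  · have hμS : μ ∈ S := hδ₁S (ball_subset_ball (min_le_left _ _) hμ)
    have hα : ((0 : ℂ), μ.1) ∈ T := by
      have : μ.1 ∈ ball (0 : ℂ) (min δ₁ δ₂) := by
        rw [mem_ball_zero_iff] at hμ ⊢
        exact lt_of_le_of_lt (norm_fst_le μ) hμ
      exact hδ₂T (ball_subset_ball (min_le_right _ _) this)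
    constructor
    · intro h4
      have hDμ : D μ = 0 := by
        simp only [hD]
        linear_combination -h4
      have h := (hleft μ hμS).2
      rw [hDμ] at h
      have h' : Ψ (0, μ.1) = μ := by simpa using h
      show μ.2 = (Ψ (0, μ.1)).2
      rw [h']
    · intro hβ
      obtain ⟨hzS, hz⟩ := hright _ hα
      have hz1 : (Ψ (0, μ.1)).1 = μ.1 := by
        have := congr_arg Prod.snd hz
        simpa using this
      have hzD : D (Ψ (0, μ.1)) = 0 := by
        have := congr_arg Prod.fst hz
        simpa using this
      have hzμ : Ψ (0, μ.1) = μ := Prod.ext hz1 (by rw [hβ])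
      rw [hzμ] at hzD
      simp only [hD] at hzD
      linear_combination -hzD

end BoundarySingularity

end Literature.Geometry.ComplexAnalytic

end
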